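import Summits.BirchSwinnertonDyer.BirchSwinnertonDyer.Theorems.GenusKolyvaginAtTwoGenusPrimitiveSupplyAtTwoGenusIdentity
import Summits.BirchSwinnertonDyer.Rank1Residual.X11b.KolyvaginRingClassCardinality
import Literature.NumberTheory.EllipticCurves.HeegnerTraceRelationProofs
import Literature.NumberTheory.EllipticCurves.HeegnerPointsOfConductorOneRationalityProofs
import Literature.NumberTheory.EllipticCurves.HeegnerPointsOfConductorOneData
import Literature.NumberTheory.EllipticCurves.HeegnerHypothesisKroneckerProofs

/-!
# Route `GenusKolyvaginAtTwo`, crux `GenusPrimitiveSupplyAtTwo` (stmt-BirchSwinnertonDyer-22136), line `genus-supply`: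
# the GENUS REDUCTION at a Kolyvagin prime — `P(ℓ) ≡ Σ_{g ∈ S·⟨σ_ℓ²⟩} g·y(ℓ) (mod 2E(K[ℓ]))`

Sequel of `…GenusIdentity.lean` (§4: `P(n) ≡ G(n) (mod 2A)`, `G(n) = Σ_{s∈S} s(∏ Σ_{i odd} σ_ℓ^i · y)`). At a PRIME
level `n = ℓ` the «odd half» `{s σ^i : s ∈ S, i ≤ ℓ odd}` and the «even half» `{s σ^i : i even} = S·⟨σ²⟩` of
`S·G_ℓ` partition it, so `G(ℓ) = Tr_{S·G_ℓ} y − Σ_{g ∈ S·⟨σ²⟩} g y`; whenever the full trace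
`Tr_{S·G_ℓ} y(ℓ) = Σ_s s(Tr_{G_ℓ} y(ℓ)) = a_ℓ · Σ_s s y(1)` (Gross 1991 Prop. 3.7 (1)) lies in `2A` — e.g. `2 ∣ a_ℓ`, which
is part of «`ℓ` is a Kolyvagin prime at `2`» — one gets the GENUS REDUCTION
`P(ℓ) ∈ 2A ⟺ Σ_{g ∈ S·⟨σ_ℓ²⟩} g·y(ℓ) ∈ 2A`: Kolyvagin `2`-primitivity at level `ℓ` is the `2`-primitivity of the trace
of `y(ℓ)` to the fixed field of `⟨σ_ℓ²⟩` summed over the coset representatives — for `S ⊂ Gal(K[ℓ]/K(√ℓ*))` this is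
the Heegner point of conductor `ℓ` traced to the GENUS FIELD `K(√ℓ*) = ℚ(√d_K, √ℓ*)`, i.e. the Heegner datum of the
twist pair `(E^{(ℓ*)}, E^{(d_K ℓ*)})` (the route's child U: «odd Heegner index of a genus pair»).
* §1 (abstract, any monoid action): `sum_sum_eq_sum_image` (reindexing a double sum through an injective
  `(s, i) ↦ s σ^i`), `exists_two_zsmul_eq_derivedPoint_iff_evenHalf` (the reduction, with the injectivity of
  `(s, i) ↦ s σ_ℓ^i` on `S × [0, ℓ]` and the `2`-divisibility of the full trace as hypotheses).
* §2 (the tree's Heegner data of prime conductor `ℓ`, `K` imaginary quadratic with `d_K < −4`, `ℓ` inert):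
  `heegner_orderOf_sigma` (`σ_ℓ` has order `ℓ + 1`: Gross §3 «`G_ℓ` cyclic of order `ℓ + 1`», via x11b3's
  `orderOf_eq_succ_of_zpowers_eq_ringClassGalOver`), `heegner_injOn_mul_pow` (`(s, i) ↦ s σ_ℓ^i` is injective on
  `S × [0, ℓ]`: `S` is a transversal of `𝒢_ℓ/G_ℓ`), `heegner_exists_two_zsmul_eq_derivedPoint_iff_evenHalf` (the
  reduction for `d.derivedPoint = P(ℓ)`, the trace hypothesis kept explicit).
* §3 (APPEND 1): the trace hypothesis DISCHARGED at a Kolyvagin prime at `2` — `Σ_{i≤ℓ} σ_ℓ^i y(ℓ) = a_ℓ · y₁` in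
  `E(K[ℓ])` (Gross Prop. 3.7 (1), the tree's proved `HeegnerTrace.finsum_mem_ringClassGalOver_eq_frobeniusTrace_smul`
  read back from `E(ℂ)`; `y₁` the conductor-`1` point pushed up `K[1] ⊆ K[ℓ]`), hence `2 ∣ a_ℓ` ⟹ full trace ∈ `2E(K[ℓ])`,
  and the UNCONDITIONAL reduction `heegner_exists_two_zsmul_eq_derivedPoint_iff_evenHalf_of_two_dvd`:
  «`P(ℓ) ∈ 2E(K[ℓ]) ⟺ even-half (genus) point ∈ 2E(K[ℓ])`» for `ℓ ∤ N_E` inert with `2 ∣ a_ℓ`, `d_K < −4`, Heegner.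
Helper for the crux item (`--supports stmt-BirchSwinnertonDyer-22136`, helper mode). No summit and no leaf is proved
by this file; BSD is not proved by any of this.
-/

set_option linter.dupNamespace false -- tree convention: `Summit.BirchSwinnertonDyer.BirchSwinnertonDyer.Theorems` (summit = sub-problem)

noncomputable section

open scoped Classical

namespace Summit.BirchSwinnertonDyer.BirchSwinnertonDyer.Theorems.GenusKoly

open Finset NumberField WeierstrassCurve Literature.NumberTheory.EllipticCurves Literature.NumberTheory.EllipticCurves.ModularForms
  Literature.NumberTheory.EllipticCurves.KolyvaginOperator

/-! ## §1 The reduction for a monoid acting on an additive group -/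

section Operator

variable {G : Type*} [Monoid G] {A : Type*} [AddCommGroup A] (ρ : G →* AddMonoid.End A)

/-- Reindexing: `Σ_{s∈S} s(Σ_{i∈I} σ^i y) = Σ_{g ∈ {sσ^i}} g y` when `(s, i) ↦ s σ^i` is injective on `S × I`. [folklore] -/
theorem sum_sum_eq_sum_image (σ : G) (S : Finset G) (I : Finset ℕ) (y : A)
    (hinj : Set.InjOn (fun p : G × ℕ ↦ p.1 * σ ^ p.2) (S ×ˢ I : Finset (G × ℕ))) :
    ∑ s ∈ S, ρ s (∑ i ∈ I, ρ (σ ^ i) y) = ∑ g ∈ (S ×ˢ I).image (fun p : G × ℕ ↦ p.1 * σ ^ p.2), ρ g y := by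
  rw [Finset.sum_image hinj, Finset.sum_product]
  refine Finset.sum_congr rfl fun s _ ↦ ?_
  rw [map_sum]
  refine Finset.sum_congr rfl fun i _ ↦ ?_
  rw [map_mul]
  rfl

/-- **The genus reduction, abstract form.** At a prime level `ℓ`, if `(s, i) ↦ s σ_ℓ^i` is injective on `S × [0, ℓ]`
and the full trace `Σ_{s∈S} s(Σ_{i≤ℓ} σ_ℓ^i y)` lies in `2A`, then the derived point `P(ℓ) = Σ_{s∈S} s(D_ℓ y)`
(Gross 1991 (4.1)) is in `2A` iff the EVEN-HALF sum `Σ_{s∈S, i≤ℓ even} (s σ_ℓ^i) y` is: by §4 of `…GenusIdentity`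
`P(ℓ) ≡` the odd-half sum, and odd half + even half = full trace `≡ 0`. [cite: GrossLMS1991, §3 (3.5) and §4 (4.1)] -/
theorem exists_two_zsmul_eq_derivedPoint_iff_evenHalf (σ : ℕ → G) {ℓ : ℕ} (hℓ : ℓ.Prime) (S : Finset G)
    (y : A) (hinj : Set.InjOn (fun p : G × ℕ ↦ p.1 * σ ℓ ^ p.2) (S ×ˢ range (ℓ + 1) : Finset (G × ℕ)))
    (htr : ∃ w : A, (2 : ℤ) • w = ∑ s ∈ S, ρ s (∑ i ∈ range (ℓ + 1), ρ (σ ℓ ^ i) y)) :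
    (∃ Q : A, (2 : ℤ) • Q = derivedPoint ρ σ ℓ S y) ↔
      ∃ Q : A, (2 : ℤ) • Q =
        ∑ g ∈ (S ×ˢ (range (ℓ + 1)).filter (fun i ↦ ¬ Odd i)).image (fun p : G × ℕ ↦ p.1 * σ ℓ ^ p.2),
          ρ g y := by
  rw [exists_two_zsmul_eq_derivedPoint_iff_oddPart, Nat.primeFactorsList_prime hℓ, List.foldr_cons,
    List.foldr_nil]
  have hinjE : Set.InjOn (fun p : G × ℕ ↦ p.1 * σ ℓ ^ p.2)
      (S ×ˢ (range (ℓ + 1)).filter (fun i ↦ ¬ Odd i) : Finset (G × ℕ)) :=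
    hinj.mono (by
      intro p hp
      simp only [Finset.coe_product, Set.mem_prod, Finset.mem_coe, Finset.mem_filter] at hp ⊢
      exact ⟨hp.1, hp.2.1⟩)
  -- full trace = odd half + even half
  have hsplit : ∑ s ∈ S, ρ s (∑ i ∈ range (ℓ + 1), ρ (σ ℓ ^ i) y) =
      ∑ s ∈ S, ρ s (∑ i ∈ (range (ℓ + 1)).filter Odd, ρ (σ ℓ ^ i) y) +
      ∑ g ∈ (S ×ˢ (range (ℓ + 1)).filter (fun i ↦ ¬ Odd i)).image (fun p : G × ℕ ↦ p.1 * σ ℓ ^ p.2),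
        ρ g y := by
    rw [← sum_sum_eq_sum_image ρ (σ ℓ) S _ y hinjE, ← Finset.sum_add_distrib]
    refine Finset.sum_congr rfl fun s _ ↦ ?_
    rw [← map_add, Finset.sum_filter_add_sum_filter_not]
  obtain ⟨w, hw⟩ := htr
  rw [hsplit] at hw
  constructor
  · rintro ⟨Q, hQ⟩
    exact ⟨w - Q, by rw [smul_sub, hw, hQ, add_sub_cancel_left]⟩
  · rintro ⟨Q, hQ⟩
    exact ⟨w - Q, by rw [smul_sub, hw, hQ, add_sub_cancel_right]⟩

end Operator

/-! ## §2 The tree's Heegner data of prime conductor -/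

section Heegner

variable {W : WeierstrassCurve ℚ} [NeZero (W.conductorNorm ℤ)] {K : Type} [Field K] [NumberField K]
  {Dt : ModularParametrizationData W (W.conductorNorm ℤ)} {β : ℤ} {ι : K →+* ℂ}

/-- **`σ_ℓ` has order `ℓ + 1`** (Gross 1991 §3: «`G_ℓ ≃ F_λ^×/F_ℓ^×` cyclic of order `ℓ + 1`», «`σ_ℓ` a fixed generator
of `G_ℓ`») for the tree's datum of prime conductor `ℓ`: `K` imaginary quadratic with `d_K < −4`, `ℓ` inert in `K`
(x11b3's `orderOf_eq_succ_of_zpowers_eq_ringClassGalOver` fed with `d.zpowers_σ`). [cite: GrossLMS1991, §3 (G_ℓ, σ_ℓ)] -/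
theorem heegner_orderOf_sigma (hK : IsImaginaryQuadratic K) (hD : NumberField.discr K < -4) {ℓ : ℕ}
    (hℓ : ℓ.Prime) (hinert : (Ideal.span {(ℓ : 𝓞 K)}).IsPrime) (d : KolyvaginHeegnerData Dt β ι ℓ) :
    orderOf (d.σ ℓ) = ℓ + 1 := by
  have h1 : ℓ / ℓ = 1 := Nat.div_self hℓ.pos
  refine Summit.BirchSwinnertonDyer.Rank1Residual.X11b.RingClassTower.orderOf_eq_succ_of_zpowers_eq_ringClassGalOver
    hK ι hℓ hinert (dvd_refl ℓ) (by rw [h1]; exact hℓ.not_dvd_one) hℓ.ne_zero (Or.inr hD) ?_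
  exact d.zpowers_σ ℓ (by rw [Nat.Prime.primeFactors hℓ]; exact Finset.mem_singleton_self ℓ)

/-- Powers of `σ_ℓ` lie in `G_ℓ = Gal(K[ℓ]/K[1])`. [cite: GrossLMS1991, §3 (G_ℓ, σ_ℓ)] -/
theorem heegner_sigma_pow_mem {ℓ : ℕ} (hℓ : ℓ.Prime) (d : KolyvaginHeegnerData Dt β ι ℓ) (i : ℕ) :
    d.σ ℓ ^ i ∈ ringClassGalOver ι ℓ 1 := by
  have h := d.zpowers_σ ℓ (by rw [Nat.Prime.primeFactors hℓ]; exact Finset.mem_singleton_self ℓ)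
  rw [Nat.div_self hℓ.pos] at h
  rw [← h]
  exact Subgroup.npow_mem_zpowers _ i

/-- **`(s, i) ↦ s σ_ℓ^i` is injective on `S × [0, ℓ]`** (Gross 1991 §3–§4: `S` a set of coset representatives of
`G_ℓ = ⟨σ_ℓ⟩` in `𝒢_ℓ`, `σ_ℓ` of order `ℓ + 1`): `s σ^i = s' σ^j` puts `s, s'` in the same `G_ℓ`-coset, so `s = s'`
by transversality (`S_transversal`), and then `i = j` below the order. [cite: GrossLMS1991, §3–§4 (S, σ_ℓ)] -/
theorem heegner_injOn_mul_pow (hK : IsImaginaryQuadratic K) (hD : NumberField.discr K < -4) {ℓ : ℕ}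
    (hℓ : ℓ.Prime) (hinert : (Ideal.span {(ℓ : 𝓞 K)}).IsPrime) (d : KolyvaginHeegnerData Dt β ι ℓ) :
    Set.InjOn (fun p : (ringClassField K ι ℓ ≃ₐ[ℚ] ringClassField K ι ℓ) × ℕ ↦ p.1 * d.σ ℓ ^ p.2)
      (d.S ×ˢ range (ℓ + 1) : Finset ((ringClassField K ι ℓ ≃ₐ[ℚ] ringClassField K ι ℓ) × ℕ)) := by
  rintro ⟨s, i⟩ hp ⟨s', j⟩ hp' h
  simp only [Finset.coe_product, Set.mem_prod, Finset.mem_coe, Finset.mem_range] at hp hp'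
  simp only at h
  -- `s = s'`: both are the representative of the coset of `g = s σ^i = s' σ^j`
  have hg : s * d.σ ℓ ^ i ∈ ringClassGal ι ℓ :=
    Subgroup.mul_mem _ (d.S_subset s hp.1) (ringClassGalOver_le_ringClassGal ι ℓ 1 (heegner_sigma_pow_mem hℓ d i))
  obtain ⟨t, -, huniq⟩ := d.S_transversal (s * d.σ ℓ ^ i) hg
  have hs : s = t := huniq s ⟨hp.1, by
    rw [mul_inv_rev, mul_assoc, inv_mul_cancel, mul_one]
    exact Subgroup.inv_mem _ (heegner_sigma_pow_mem hℓ d i)⟩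
  have hs' : s' = t := huniq s' ⟨hp'.1, by
    rw [h, mul_inv_rev, mul_assoc, inv_mul_cancel, mul_one]
    exact Subgroup.inv_mem _ (heegner_sigma_pow_mem hℓ d j)⟩
  have hss' : s = s' := hs.trans hs'.symm
  subst hss'
  -- `i = j` below the order `ℓ + 1`
  have hij : d.σ ℓ ^ i = d.σ ℓ ^ j := mul_left_cancel h
  have hord := heegner_orderOf_sigma hK hD hℓ hinert d
  have := pow_injOn_Iio_orderOf (x := d.σ ℓ) (by rw [Set.mem_Iio, hord]; exact hp.2)
    (by rw [Set.mem_Iio, hord]; exact hp'.2) hij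
  rw [this]

/-- **The genus reduction for `P(ℓ) ∈ E(K[ℓ])`** (Gross 1991 (4.1) with the genus identity of this lineage): for the
tree's datum `d` of prime conductor `ℓ` (`K` imaginary quadratic, `d_K < −4`, `ℓ` inert), IF the full trace
`Σ_{s∈S} s(Σ_{i≤ℓ} σ_ℓ^i y(ℓ)) = Σ_s s(Tr_{K[ℓ]/K[1]} y(ℓ))` lies in `2E(K[ℓ])` (by Gross Prop. 3.7 (1) it is
`a_ℓ · Σ_s s y(1)`, so this holds when `2 ∣ a_ℓ`, i.e. for a Kolyvagin prime at `2`), THEN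
`P(ℓ) ∈ 2E(K[ℓ]) ⟺ Σ_{s∈S, i≤ℓ even} (s σ_ℓ^i)·y(ℓ) ∈ 2E(K[ℓ])` — the even half `S·⟨σ_ℓ²⟩`, i.e. the trace of `y(ℓ)`
to the fixed field of `σ_ℓ²` summed over `S` (for `S` inside `Gal(K[ℓ]/K(√ℓ*))`: the Heegner point over the genus
field `ℚ(√d_K, √ℓ*)`). [cite: GrossLMS1991, §3 (3.5), Prop. 3.7 (1), §4 (4.1)] -/
theorem heegner_exists_two_zsmul_eq_derivedPoint_iff_evenHalf (hK : IsImaginaryQuadratic K)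
    (hD : NumberField.discr K < -4) {ℓ : ℕ} (hℓ : ℓ.Prime) (hinert : (Ideal.span {(ℓ : 𝓞 K)}).IsPrime)
    (d : KolyvaginHeegnerData Dt β ι ℓ)
    (htr : ∃ w : (W.baseChange (ringClassField K ι ℓ)).toAffine.Point, (2 : ℤ) • w =
      ∑ s ∈ d.S, pointGalHom W (ringClassField K ι ℓ) s
        (∑ i ∈ range (ℓ + 1), pointGalHom W (ringClassField K ι ℓ) (d.σ ℓ ^ i) d.y)) :
    (∃ Q : (W.baseChange (ringClassField K ι ℓ)).toAffine.Point, (2 : ℤ) • Q = d.derivedPoint) ↔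
      ∃ Q : (W.baseChange (ringClassField K ι ℓ)).toAffine.Point, (2 : ℤ) • Q =
        ∑ g ∈ (d.S ×ˢ (range (ℓ + 1)).filter (fun i ↦ ¬ Odd i)).image
            (fun p : (ringClassField K ι ℓ ≃ₐ[ℚ] ringClassField K ι ℓ) × ℕ ↦ p.1 * d.σ ℓ ^ p.2),
          pointGalHom W (ringClassField K ι ℓ) g d.y :=
  exists_two_zsmul_eq_derivedPoint_iff_evenHalf _ d.σ hℓ d.S d.y (heegner_injOn_mul_pow hK hD hℓ hinert d) htr

/-! ### §3 (APPEND 1, same seat) The full trace IS in `2E(K[ℓ])` at a Kolyvagin prime at `2` -/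

/-- For ABSTRACT subfields `S ≤ T` of a characteristic-`0` field `L` and a point `P ∈ E(S)`: pushing `P` to `E(T)` and
then to `E(L)` is pushing it to `E(L)` (stated abstractly so that the kernel never compares two concrete ring class
fields definitionally; same device as `HeegnerPointsOfConductorOneData`). [folklore] -/
theorem map_subtype_map_inclusion_eq {L : Type*} [Field L] [CharZero L] {S T : Subfield L} (h : S ≤ T)
    (V : WeierstrassCurve ℚ) (P : (V.baseChange S).toAffine.Point) :
    WeierstrassCurve.Affine.Point.map T.subtype.toRatAlgHom
        (WeierstrassCurve.Affine.Point.map (W' := V) (Subfield.inclusion h).toRatAlgHom P) =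
      WeierstrassCurve.Affine.Point.map S.subtype.toRatAlgHom P := by
  have hcomp : (T.subtype.toRatAlgHom).comp (Subfield.inclusion h).toRatAlgHom = S.subtype.toRatAlgHom :=
    AlgHom.ext fun _ ↦ rfl
  rw [WeierstrassCurve.Affine.Point.map_map, hcomp]

/-- **The conductor-`1` Heegner point inside `E(K[ℓ])`**: `K[1] ⊆ K[ℓ]` (Gross 1991 §3, field diagram; tree
`ringClassField_mono`) and `y(1) ∈ E(K[1])` over `x(1)` (Darmon Thm. 3.6, PROVED: `exists_map_eq_heegnerPointComplexOfConductor_one`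
∘ `phi_heegnerTau_mem_singularModuliField_holds`) give a point of `E(K[ℓ])` over `x(1) ∈ E(ℂ)`.
[cite: GrossLMS1991, §3 (K ⊂ K_1 ⊂ K_n)] [cite: Darmon2004, Thm. 3.6] -/
theorem heegner_exists_map_eq_heegnerPointComplexOfConductor_one [W.IsElliptic] (hK : IsImaginaryQuadratic K)
    {ℓ : ℕ} (hℓ : ℓ ≠ 0) (d : KolyvaginHeegnerData Dt β ι ℓ) :
    ∃ y₁ : (W.baseChange (ringClassField K ι ℓ)).toAffine.Point,
      WeierstrassCurve.Affine.Point.map (W' := W) (ringClassField K ι ℓ).subtype.toRatAlgHom y₁ =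
        heegnerPointComplexOfConductor Dt (NumberField.discr K) β 1 := by
  obtain ⟨y₀, hy₀⟩ := exists_map_eq_heegnerPointComplexOfConductor_one
    (phi_heegnerTau_mem_singularModuliField_holds (W.conductorNorm ℤ) W K) hK Dt ι d.dvd_sq_sub
  have hle : ringClassField K ι 1 ≤ ringClassField K ι ℓ := ringClassField_mono hK ι (one_dvd ℓ) hℓ
  exact ⟨WeierstrassCurve.Affine.Point.map (W' := W) (Subfield.inclusion hle).toRatAlgHom y₀,
    (map_subtype_map_inclusion_eq hle W y₀).trans hy₀⟩

/-- **`G_ℓ = {σ_ℓ^i : i ≤ ℓ}`** as a subset of `Aut_ℚ(K[ℓ])` (`σ_ℓ` generates `G_ℓ` and has order `ℓ + 1`).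
[cite: GrossLMS1991, §3 (G_ℓ, σ_ℓ)] -/
theorem heegner_coe_ringClassGalOver_eq_image_pow (hK : IsImaginaryQuadratic K) (hD : NumberField.discr K < -4)
    {ℓ : ℕ} (hℓ : ℓ.Prime) (hinert : (Ideal.span {(ℓ : 𝓞 K)}).IsPrime) (d : KolyvaginHeegnerData Dt β ι ℓ) :
    (ringClassGalOver ι ℓ 1 : Set (ringClassField K ι ℓ ≃ₐ[ℚ] ringClassField K ι ℓ)) =
      ↑((range (ℓ + 1)).image (d.σ ℓ ^ ·)) := by
  have hord := heegner_orderOf_sigma hK hD hℓ hinert d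
  have hfin : IsOfFinOrder (d.σ ℓ) := orderOf_pos_iff.mp (by rw [hord]; exact Nat.succ_pos ℓ)
  ext g
  have h := d.zpowers_σ ℓ (by rw [Nat.Prime.primeFactors hℓ]; exact Finset.mem_singleton_self ℓ)
  rw [Nat.div_self hℓ.pos] at h
  rw [SetLike.mem_coe, ← h, hfin.mem_zpowers_iff_mem_range_orderOf, hord, Finset.mem_coe]

/-- **`Σ_{i≤ℓ} σ_ℓ^i y(ℓ) ↦ a_ℓ · x(1)` in `E(ℂ)`** (Gross 1991 Prop. 3.7 (1), the tree's DISCHARGED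
`HeegnerTrace.finsum_mem_ringClassGalOver_eq_frobeniusTrace_smul` at `(n, m) = (ℓ, 1)`, with its `∑ᶠ` over `G_ℓ` rewritten
as the sum over the powers `σ_ℓ^i`, `i ≤ ℓ`). [cite: GrossLMS1991, §3 Prop. 3.7 (1)] -/
theorem heegner_map_sum_pow_sigma_eq [W.IsElliptic] [W.IsGloballyMinimal] (hK : IsImaginaryQuadratic K)
    (hD : NumberField.discr K < -4) (hH : SatisfiesHeegnerHypothesis (W.conductorNorm ℤ) K) {ℓ : ℕ}
    (hℓ : ℓ.Prime) (hinert : (Ideal.span {(ℓ : 𝓞 K)}).IsPrime) (hℓN : ¬ ℓ ∣ W.conductorNorm ℤ)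
    (d : KolyvaginHeegnerData Dt β ι ℓ) :
    WeierstrassCurve.Affine.Point.map (W' := W) (ringClassField K ι ℓ).subtype.toRatAlgHom
        (∑ i ∈ range (ℓ + 1), pointGalHom W (ringClassField K ι ℓ) (d.σ ℓ ^ i) d.y) =
      (W.frobeniusTrace ℓ) • heegnerPointComplexOfConductor Dt (NumberField.discr K) β 1 := by
  have hND : IsCoprime (W.conductorNorm ℤ : ℤ) (NumberField.discr K) := by
    have h := Literature.SatisfiesHeegnerHypothesis.coprime_discr hK.1 hH
    refine Int.isCoprime_iff_gcd_eq_one.mpr ?_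
    rw [Int.gcd_eq_natAbs, Int.natAbs_natCast]
    exact h
  have hℓ1 : ¬ ℓ ∣ 1 := hℓ.not_dvd_one
  have htr := HeegnerTrace.finsum_mem_ringClassGalOver_eq_frobeniusTrace_smul hK ι Dt hND d.dvd_sq_sub hℓ hinert
    hℓN hℓ1 one_ne_zero (Nat.coprime_one_right _) (Or.inr hD) (mul_one ℓ) d.map_y
  have hord := heegner_orderOf_sigma hK hD hℓ hinert d
  have hinj : Set.InjOn (d.σ ℓ ^ ·) (range (ℓ + 1) : Finset ℕ) := by
    intro i hi j hj hij
    exact pow_injOn_Iio_orderOf (x := d.σ ℓ) (by rw [Set.mem_Iio, hord]; exact Finset.mem_range.mp hi)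
      (by rw [Set.mem_Iio, hord]; exact Finset.mem_range.mp hj) hij
  rw [heegner_coe_ringClassGalOver_eq_image_pow hK hD hℓ hinert d, finsum_mem_coe_finset,
    Finset.sum_image hinj] at htr
  rw [map_sum]
  exact htr

/-- **`Σ_{i≤ℓ} σ_ℓ^i y(ℓ) = a_ℓ · y₁` in `E(K[ℓ])`** for some `y₁ ∈ E(K[ℓ])` over `x(1)` (Gross 1991 Prop. 3.7 (1)
«`Tr_ℓ y_n = a_ℓ y_{n/ℓ}`», read back from `E(ℂ)` along the injective `E(K[ℓ]) → E(ℂ)`): `K` imaginary quadratic with the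
Heegner hypothesis for `N_E` and `d_K < −4`, `ℓ ∤ N_E` a prime inert in `K`, `d` the tree's datum of conductor `ℓ`.
[cite: GrossLMS1991, §3 Prop. 3.7 (1)] -/
theorem heegner_sum_pow_sigma_eq_frobeniusTrace_zsmul [W.IsElliptic] [W.IsGloballyMinimal]
    (hK : IsImaginaryQuadratic K) (hD : NumberField.discr K < -4)
    (hH : SatisfiesHeegnerHypothesis (W.conductorNorm ℤ) K) {ℓ : ℕ} (hℓ : ℓ.Prime)
    (hinert : (Ideal.span {(ℓ : 𝓞 K)}).IsPrime) (hℓN : ¬ ℓ ∣ W.conductorNorm ℤ)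
    (d : KolyvaginHeegnerData Dt β ι ℓ) :
    ∃ y₁ : (W.baseChange (ringClassField K ι ℓ)).toAffine.Point,
      WeierstrassCurve.Affine.Point.map (W' := W) (ringClassField K ι ℓ).subtype.toRatAlgHom y₁ =
        heegnerPointComplexOfConductor Dt (NumberField.discr K) β 1 ∧
      ∑ i ∈ range (ℓ + 1), pointGalHom W (ringClassField K ι ℓ) (d.σ ℓ ^ i) d.y = (W.frobeniusTrace ℓ) • y₁ := by
  obtain ⟨y₁, hy₁⟩ := heegner_exists_map_eq_heegnerPointComplexOfConductor_one hK hℓ.ne_zero d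
  refine ⟨y₁, hy₁, ?_⟩
  apply WeierstrassCurve.Affine.Point.map_injective (W' := W) (ringClassField K ι ℓ).subtype.toRatAlgHom
  rw [heegner_map_sum_pow_sigma_eq hK hD hH hℓ hinert hℓN d, map_zsmul, hy₁]

/-- **At a Kolyvagin prime at `2` the full trace is `2`-divisible**: with `2 ∣ a_ℓ` (part of «`ℓ` is a Kolyvagin prime at
`2`»), `Σ_{s∈S} s(Σ_{i≤ℓ} σ_ℓ^i y(ℓ)) = a_ℓ · Σ_s s y₁ ∈ 2E(K[ℓ])` — the hypothesis `htr` of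
`heegner_exists_two_zsmul_eq_derivedPoint_iff_evenHalf`. [cite: GrossLMS1991, §3 (3.3) and Prop. 3.7 (1)] -/
theorem heegner_exists_two_zsmul_eq_fullTrace [W.IsElliptic] [W.IsGloballyMinimal]
    (hK : IsImaginaryQuadratic K) (hD : NumberField.discr K < -4)
    (hH : SatisfiesHeegnerHypothesis (W.conductorNorm ℤ) K) {ℓ : ℕ} (hℓ : ℓ.Prime)
    (hinert : (Ideal.span {(ℓ : 𝓞 K)}).IsPrime) (hℓN : ¬ ℓ ∣ W.conductorNorm ℤ)
    (ha : (2 : ℤ) ∣ W.frobeniusTrace ℓ) (d : KolyvaginHeegnerData Dt β ι ℓ) :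
    ∃ w : (W.baseChange (ringClassField K ι ℓ)).toAffine.Point, (2 : ℤ) • w =
      ∑ s ∈ d.S, pointGalHom W (ringClassField K ι ℓ) s
        (∑ i ∈ range (ℓ + 1), pointGalHom W (ringClassField K ι ℓ) (d.σ ℓ ^ i) d.y) := by
  obtain ⟨y₁, -, hsum⟩ := heegner_sum_pow_sigma_eq_frobeniusTrace_zsmul hK hD hH hℓ hinert hℓN d
  obtain ⟨c, hc⟩ := ha
  refine ⟨c • ∑ s ∈ d.S, pointGalHom W (ringClassField K ι ℓ) s y₁, ?_⟩
  rw [hsum, smul_smul, ← hc, Finset.smul_sum]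
  exact Finset.sum_congr rfl fun s _ ↦ (map_zsmul _ _ _).symm

/-- **THE GENUS REDUCTION AT A KOLYVAGIN PRIME AT `2`, unconditional form**: for `E/ℚ` (globally minimal `W`), `K`
imaginary quadratic with the Heegner hypothesis and `d_K < −4`, `ℓ ∤ N_E` a prime inert in `K` with `2 ∣ a_ℓ`, and the
tree's datum `d` of conductor `ℓ`: `P(ℓ) ∈ 2E(K[ℓ]) ⟺ Σ_{s∈S, i≤ℓ even} (s σ_ℓ^i)·y(ℓ) ∈ 2E(K[ℓ])`. So the registered
stub C of line `genus-supply` at a single Kolyvagin prime is EXACTLY the non-`2`-divisibility of the even-half (genus)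
point. [cite: GrossLMS1991, §3 (3.3), (3.5), Prop. 3.7 (1), §4 (4.1)] -/
theorem heegner_exists_two_zsmul_eq_derivedPoint_iff_evenHalf_of_two_dvd [W.IsElliptic] [W.IsGloballyMinimal]
    (hK : IsImaginaryQuadratic K) (hD : NumberField.discr K < -4)
    (hH : SatisfiesHeegnerHypothesis (W.conductorNorm ℤ) K) {ℓ : ℕ} (hℓ : ℓ.Prime)
    (hinert : (Ideal.span {(ℓ : 𝓞 K)}).IsPrime) (hℓN : ¬ ℓ ∣ W.conductorNorm ℤ)
    (ha : (2 : ℤ) ∣ W.frobeniusTrace ℓ) (d : KolyvaginHeegnerData Dt β ι ℓ) :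
    (∃ Q : (W.baseChange (ringClassField K ι ℓ)).toAffine.Point, (2 : ℤ) • Q = d.derivedPoint) ↔
      ∃ Q : (W.baseChange (ringClassField K ι ℓ)).toAffine.Point, (2 : ℤ) • Q =
        ∑ g ∈ (d.S ×ˢ (range (ℓ + 1)).filter (fun i ↦ ¬ Odd i)).image
            (fun p : (ringClassField K ι ℓ ≃ₐ[ℚ] ringClassField K ι ℓ) × ℕ ↦ p.1 * d.σ ℓ ^ p.2),
          pointGalHom W (ringClassField K ι ℓ) g d.y :=
  heegner_exists_two_zsmul_eq_derivedPoint_iff_evenHalf hK hD hℓ hinert d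
    (heegner_exists_two_zsmul_eq_fullTrace hK hD hH hℓ hinert hℓN ha d)

end Heegner

end Summit.BirchSwinnertonDyer.BirchSwinnertonDyer.Theorems.GenusKoly

end
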